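import Mathlib
import Literature.Computability.Complexity.ExtMonotoneGates
import Literature.Computability.Complexity.CliqueApproximatorsWide
import Literature.Computability.Complexity.RossmanMonotoneCliqueProb
import Literature.Computability.Complexity.RossmanMonotoneCliqueGraphs
import Summits.PneNP.PneNP.Theorems.ConvexRankGatesLinAlgGateBlindDefs
import Summits.PneNP.PneNP.Theorems.ConvexRankGatesLinAlgGateBlindDenseRegime
import Summits.PneNP.PneNP.Theorems.ConvexRankGatesLinAlgGateBlindDenseRegimeAux
import Summits.PneNP.PneNP.Theorems.ConvexRankGatesLinAlgGateBlindSGGRankCalibration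
import Summits.PneNP.PneNP.Theorems.CliqueExtLowerBound.Negative.PermConsequences

/-!
# Calibration of the child `SGPerm` of crux `LinAlgGateBlind` (stmt-PneNP-10681, route ConvexRankGates)

The strategist's split of the crux (`Cruxes/LinAlgGateBlind/SPLIT.md`, glue landed as
`Theorems/ConvexRankGatesLinAlgGateBlindSplit.lean`) has as its first child the single-gate statement
`SGPerm : ∀ c, ∀ᶠ m, SGAt m (IsPermGate (m ^ c)) (lOf m) (kOf m) (qOf m) (epsOf c m)` — every PERM term gate over
`≤ lOf m`-clique atoms has a one-sided small-clique DNF approximator on (bare `kOf m`-cliques, `G(m, qOf m)`).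
This file records, kernel-checked and class-free, HOW STRONG that statement is in the worst case:

* `isTermGate_of_wiring` — any gate of any class `P`, its inputs wired to edges (repetitions allowed), is a
  `P`-term gate over the 2-vertex atoms (`l ≥ 2`).
* `not_sgAt_of_isTermGate_cliqueFn` — an EXACT `CLIQUE(m,k)` term gate of class `P` refutes `SGAt m P l k q ε`
  as soon as `Pr_{G(m,q)}[CLIQUE] + ε < q^{C(l,2)}` and `ε < 1` (the argument of `sgAt_gRank_dc_lowerBound`,
  extracted: `𝒜 = ∅` loses all `C(m,k)` bare cliques, a member `X ∈ 𝒜` gains `≥ q^{C(l,2)} − Pr[CLIQUE] > ε`).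
* `not_computes_cliqueFn_of_sgAt` — hence `SGAt m P l k q ε` forbids every SINGLE `P`-gate wired to the edges
  from computing `CLIQUE(m,k)`.
* `not_generatorGate_cliqueFn_of_sgAt_perm` — for `P = IsPermGate s`: no subgroup-membership test
  `[τ ∈ ⟨σ_i : x(w i) = 1⟩]` on `≤ s` points computes `CLIQUE(m,k)`;
  `not_spanProgram_cliqueFn_of_sgAt_perm` — no monotone span program over `𝔽₂` of dimension `#κ`,
  `2·#κ ≤ s`, rows owned by edges, computes `CLIQUE(m,k)` (`Negative.spanGate_isPermGate`);
  `not_abelianProgram_cliqueFn_of_sgAt_perm` — the same over any finite abelian group `G`, `#G·#κ ≤ s`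
  (`Negative.abelianProgram_isPermGate`).
* `sgPerm_forces_onePermGate_blind`, `sgPerm_forces_mspDim_lowerBound` — the asymptotic packaging with the
  landed dense-regime numerics (`stub_denseRegime`: `Pr[CLIQUE] ≤ 1/4`, `q^{C(l,2)} ≥ 1/2`, `m^c ε ≤ 1/16`):
  the child statement `SGPerm` VERBATIM implies that for every `c`, eventually in `m`, no PERM gate on `≤ m^c`
  points wired to the edges — in particular no monotone `𝔽₂` span program of dimension `≤ m^c / 2` — computes
  `CLIQUE(m, ⌈m^{1/8}⌉₊)`: a superpolynomial monotone-span-program size lower bound for this clique family.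

So any proof of `SGPerm`, even of its abelian (`𝔽_p`-span) sub-case, is at least a superpolynomial monotone
span-program lower bound for `CLIQUE(m, ⌈m^{1/8}⌉₊)` over the corresponding prime field (in print such bounds
come only from rank-measure/lifting theorems, Robere–Pitassi–Rossman–Cook 2016, Pitassi–Robere 2018); the
nonabelian case is a lower bound for generator-selection membership programs in symmetric groups. Nothing here
claims `SGPerm`. Sources: Karchmer–Wigderson 1993 (span programs); Alon–Boppana 1987 §3 (referee pair);
the sibling calibration `sgAt_gRank_dc_lowerBound`. [folklore]
-/

-- `Summit.PneNP.PneNP.…` duplicates `PneNP` BY DESIGN (single-problem summit).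
set_option linter.dupNamespace false

noncomputable section

namespace Summit.PneNP.PneNP.Theorems

open scoped BigOperators
open Finset Filter Literature.Computability.Complexity Razborov
open Summit.PneNP.PneNP.Cruxes.LinAlgGateBlind.DnfInvariantWideGatesSeeSmallCliques
open Summit.PneNP.PneNP.Theorems.CliqueExtLowerBound.Negative
  (spanGate_isPermGate card_zmod_two_prod abelianProgram_isPermGate card_group_prod)

/-! ### Generic part (any gate class `P`) -/

/-- **Wired gates are term gates.** A gate `g` of class `P` whose inputs are wired to edges `w i` is a
`P`-term gate over the 2-vertex atoms `endpts (w i) ∈ 𝒱(l)` (`l ≥ 2`; `⌈endpts e⌉(x) = x e`). [folklore] -/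
theorem isTermGate_of_wiring {m l : ℕ} {P : GateFn → Prop} (hl : 2 ≤ l) {g : GateFn} (hg : P g)
    (w : Fin g.1 → KEdge m) : IsTermGate m P l (fun x => g.2 fun i => x (w i)) := by
  refine ⟨g, hg, fun i => endpts (w i), fun i => ?_, fun x => ?_⟩
  · rw [mem_smallSets, card_endpts]
    omega
  · simp only [atomB_endpts]

/-- **An exact CLIQUE term gate refutes `SG`.** If `CLIQUE(m,k)` itself is a `P`-term gate over `≤ l`-atoms
and `Pr_{G(m,q)}[CLIQUE(m,k)] + ε < q^{C(l,2)}`, `ε < 1`, `2 ≤ k ≤ m`, `q ∈ [0,1]`, then `SGAt m P l k q ε`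
fails: `𝒜 = ∅` loses all `C(m,k) > ε·C(m,k)` bare `k`-cliques, and a member `X ∈ 𝒜` (`#X ≤ l`) gains at
least `Pr[⌈X⌉] − Pr[CLIQUE] ≥ q^{C(l,2)} − Pr[CLIQUE] > ε` of `G(m,q)` (the argument of
`sgAt_gRank_dc_lowerBound`, made class-free). [folklore] -/
theorem not_sgAt_of_isTermGate_cliqueFn {m l k : ℕ} {P : GateFn → Prop} {q ε : ℝ} (hk : 2 ≤ k)
    (hkm : k ≤ m) (hq0 : 0 ≤ q) (hq1 : q ≤ 1) (hε : ε < 1)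
    (hgap : prob q (fun x : KEdge m → Bool => cliqueFn m k x = true) + ε < q ^ (l.choose 2))
    (hT : IsTermGate m P l (cliqueFn m k)) : ¬ SGAt m P l k q ε := by
  classical
  intro hSG
  obtain ⟨𝒜, h𝒜, hlost, hgain⟩ := hSG _ hT
  rcases 𝒜.eq_empty_or_nonempty with rfl | ⟨X, hX⟩
  · -- `𝒜 = ∅` loses every bare `k`-clique
    have hall : lostPos m k (cliqueFn m k) ∅ = powersetCard k univ := by
      rw [lostPos]
      refine filter_true_of_mem fun S hS => ⟨cliqueFn_cliqueVec (by rw [(mem_powersetCard.1 hS).2]), ?_⟩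
      rintro ⟨W, hW, -⟩
      exact absurd hW (notMem_empty W)
    rw [hall, card_powersetCard, card_univ, Fintype.card_fin] at hlost
    have hpos : (0 : ℝ) < m.choose k := by exact_mod_cast Nat.choose_pos hkm
    have h2 : 2 ≤ k := hk
    nlinarith [mul_pos (sub_pos.2 hε) hpos]
  · -- a member `X ∈ 𝒜` gains too many negatives
    have hXl : #X ≤ l := (mem_smallSets.1 (h𝒜 hX)).1
    have h1 : prob q (fun x : KEdge m → Bool => CliquePresent X x) ≤
        prob q (fun x : KEdge m → Bool => cliqueFn m k x = true) +
          prob q (fun x : KEdge m → Bool => CliquePresent X x ∧ ¬ cliqueFn m k x = true) :=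
      prob_le_prob_add_prob_and_not hq0 hq1 _ _
    have h2 : prob q (fun x : KEdge m → Bool => CliquePresent X x ∧ ¬ cliqueFn m k x = true) ≤
        gainedNeg m q (cliqueFn m k) 𝒜 :=
      prob_mono hq0 hq1 fun x hx => ⟨Bool.eq_false_iff.2 hx.2, X, hX, hx.1⟩
    have h3 := pow_choose_le_prob_cliquePresent (m := m) hq0 hq1 hXl
    linarith

/-- **`SG` forbids one-gate CLIQUE.** Under the same numerics, `SGAt m P l k q ε` (with `l ≥ 2`) implies
that NO single gate of class `P`, its inputs wired to the edges in any way, computes `CLIQUE(m,k)`. [folklore] -/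
theorem not_computes_cliqueFn_of_sgAt {m l k : ℕ} {P : GateFn → Prop} {q ε : ℝ} (hl : 2 ≤ l) (hk : 2 ≤ k)
    (hkm : k ≤ m) (hq0 : 0 ≤ q) (hq1 : q ≤ 1) (hε : ε < 1)
    (hgap : prob q (fun x : KEdge m → Bool => cliqueFn m k x = true) + ε < q ^ (l.choose 2))
    (hSG : SGAt m P l k q ε) {g : GateFn} (hg : P g) (w : Fin g.1 → KEdge m) :
    ¬ ∀ x : KEdge m → Bool, g.2 (fun i => x (w i)) = cliqueFn m k x := by
  intro hcomp
  refine not_sgAt_of_isTermGate_cliqueFn hk hkm hq0 hq1 hε hgap ?_ hSG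
  have hfun : (fun x : KEdge m → Bool => g.2 fun i => x (w i)) = cliqueFn m k := funext hcomp
  exact hfun ▸ isTermGate_of_wiring hl hg w

/-! ### PERM specialisations -/

/-- **No generator-selection membership test computes CLIQUE.** Under the numerics above,
`SGAt m (IsPermGate s) l k q ε` implies: for `d ≤ s`, no test `[τ ∈ ⟨σ_i : x (w i) = 1⟩]` with
`σ_i, τ ∈ Sym(Fin d)` and wires `w i` reading edges computes `CLIQUE(m,k)`. [folklore] -/
theorem not_generatorGate_cliqueFn_of_sgAt_perm {m l k s : ℕ} {q ε : ℝ} (hl : 2 ≤ l) (hk : 2 ≤ k)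
    (hkm : k ≤ m) (hq0 : 0 ≤ q) (hq1 : q ≤ 1) (hε : ε < 1)
    (hgap : prob q (fun x : KEdge m → Bool => cliqueFn m k x = true) + ε < q ^ (l.choose 2))
    (hSG : SGAt m (IsPermGate s) l k q ε) {d : ℕ} (hd : d ≤ s) {n : ℕ}
    (σ : Fin n → Equiv.Perm (Fin d)) (τ : Equiv.Perm (Fin d)) (w : Fin n → KEdge m) :
    ¬ ∀ x : KEdge m → Bool,
      (τ ∈ Subgroup.closure (σ '' {i | x (w i) = true}) ↔ cliqueFn m k x = true) := by
  classical
  intro hcomp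
  let g : GateFn := ⟨n, fun v => decide (τ ∈ Subgroup.closure (σ '' {i | v i = true}))⟩
  have hg : IsPermGate s g := ⟨d, hd, σ, τ, fun v => by simp [g]⟩
  refine not_computes_cliqueFn_of_sgAt hl hk hkm hq0 hq1 hε hgap hSG hg w fun x => ?_
  apply Bool.eq_iff_iff.2
  change decide (τ ∈ Subgroup.closure (σ '' {i | x (w i) = true})) = true ↔ _
  rw [decide_eq_true_iff]
  exact hcomp x

/-- **No monotone `𝔽₂` span program of dimension `≤ s/2` computes CLIQUE.** Under the numerics above,
`SGAt m (IsPermGate s) l k q ε` implies: no span program over `𝔽₂` with rows `ρ i ∈ 𝔽₂^κ` owned by wires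
reading edges, `2·#κ ≤ s`, target `t`, computes `CLIQUE(m,k)` (such a program is ONE PERM gate on `2·#κ`
points, `Negative.spanGate_isPermGate`). [folklore] -/
theorem not_spanProgram_cliqueFn_of_sgAt_perm {m l k s : ℕ} {q ε : ℝ} (hl : 2 ≤ l) (hk : 2 ≤ k)
    (hkm : k ≤ m) (hq0 : 0 ≤ q) (hq1 : q ≤ 1) (hε : ε < 1)
    (hgap : prob q (fun x : KEdge m → Bool => cliqueFn m k x = true) + ε < q ^ (l.choose 2))
    (hSG : SGAt m (IsPermGate s) l k q ε) {κ : Type} [Fintype κ] (hκ : 2 * Fintype.card κ ≤ s)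
    {n : ℕ} (ρ : Fin n → κ → ZMod 2) (t : κ → ZMod 2) (w : Fin n → KEdge m) :
    ¬ ∀ x : KEdge m → Bool,
      (Multiplicative.ofAdd t ∈
          Subgroup.closure ((fun i => Multiplicative.ofAdd (ρ i)) '' {i | x (w i) = true}) ↔
        cliqueFn m k x = true) := by
  classical
  intro hcomp
  let f : (Fin n → Bool) → Bool := fun v => decide (Multiplicative.ofAdd t ∈
    Subgroup.closure ((fun i => Multiplicative.ofAdd (ρ i)) '' {i | v i = true}))
  have hf : ∀ v, f v = true ↔ Multiplicative.ofAdd t ∈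
      Subgroup.closure ((fun i => Multiplicative.ofAdd (ρ i)) '' {i | v i = true}) := fun v => by
    simp [f]
  have hg : IsPermGate s ⟨n, f⟩ :=
    (spanGate_isPermGate ρ t f hf).mono (by rw [card_zmod_two_prod]; exact hκ)
  refine not_computes_cliqueFn_of_sgAt hl hk hkm hq0 hq1 hε hgap hSG hg w fun x => ?_
  apply Bool.eq_iff_iff.2
  change f (fun i => x (w i)) = true ↔ _
  rw [hf]
  exact hcomp x

/-- **No abelian-group program with `#G·#κ ≤ s` computes CLIQUE.** Under the numerics above,
`SGAt m (IsPermGate s) l k q ε` implies: for a finite abelian group `G`, no program "accept iff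
`t ∈ ⟨ρ i : x (w i) = 1⟩ ≤ G^κ`" with `#G·#κ ≤ s` computes `CLIQUE(m,k)` (one PERM gate on `#G·#κ` points,
`Negative.abelianProgram_isPermGate`); `G = ZMod p` is the monotone span program over `𝔽_p`. [folklore] -/
theorem not_abelianProgram_cliqueFn_of_sgAt_perm {m l k s : ℕ} {q ε : ℝ} (hl : 2 ≤ l) (hk : 2 ≤ k)
    (hkm : k ≤ m) (hq0 : 0 ≤ q) (hq1 : q ≤ 1) (hε : ε < 1)
    (hgap : prob q (fun x : KEdge m → Bool => cliqueFn m k x = true) + ε < q ^ (l.choose 2))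
    (hSG : SGAt m (IsPermGate s) l k q ε) {G : Type} [AddCommGroup G] [Fintype G] [DecidableEq G]
    {κ : Type} [Fintype κ] [DecidableEq κ] (hGκ : Fintype.card G * Fintype.card κ ≤ s)
    {n : ℕ} (ρ : Fin n → κ → G) (t : κ → G) (w : Fin n → KEdge m) :
    ¬ ∀ x : KEdge m → Bool,
      (Multiplicative.ofAdd t ∈
          Subgroup.closure ((fun i => Multiplicative.ofAdd (ρ i)) '' {i | x (w i) = true}) ↔
        cliqueFn m k x = true) := by
  classical
  intro hcomp
  let f : (Fin n → Bool) → Bool := fun v => decide (Multiplicative.ofAdd t ∈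
    Subgroup.closure ((fun i => Multiplicative.ofAdd (ρ i)) '' {i | v i = true}))
  have hf : ∀ v, f v = true ↔ Multiplicative.ofAdd t ∈
      Subgroup.closure ((fun i => Multiplicative.ofAdd (ρ i)) '' {i | v i = true}) := fun v => by
    simp [f]
  have hg : IsPermGate s ⟨n, f⟩ :=
    (abelianProgram_isPermGate ρ t f hf).mono (by rw [card_group_prod]; exact hGκ)
  refine not_computes_cliqueFn_of_sgAt hl hk hkm hq0 hq1 hε hgap hSG hg w fun x => ?_
  apply Bool.eq_iff_iff.2
  change f (fun i => x (w i)) = true ↔ _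
  rw [hf]
  exact hcomp x

/-! ### Asymptotic packaging: the child statement `SGPerm` verbatim -/

/-- The dense-regime numerics needed here, eventually in `m` for every `c`: `2 ≤ lOf m`, `2 ≤ kOf m ≤ m`,
`qOf m ∈ [0,1]`, `epsOf c m < 1` and `Pr[CLIQUE(m, kOf m)] + epsOf c m < (qOf m)^{C(lOf m, 2)}`
(from `stub_denseRegime`: `Pr[CLIQUE] ≤ 1/4`, `m^c·ε ≤ 1/16`, `q^{C(l,2)} ≥ 1/2`; and `l² ≤ k`). [folklore] -/
theorem sgPerm_numerics (c : ℕ) : ∀ᶠ m : ℕ in atTop, 2 ≤ lOf m ∧ 2 ≤ kOf m ∧ kOf m ≤ m ∧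
    0 ≤ qOf m ∧ qOf m ≤ 1 ∧ epsOf c m < 1 ∧
    prob (qOf m) (fun x : KEdge m → Bool => cliqueFn m (kOf m) x = true) + epsOf c m <
      qOf m ^ ((lOf m).choose 2) := by
  filter_upwards [stub_denseRegime c, eventually_ge_atTop 1] with m
    ⟨hl, _, hkm, hq0, hq1, _, _, hε, hprob, hhalf⟩ hm1
  have hk : 2 ≤ kOf m := by
    have h := DenseRegime.lOf_sq_le_kOf m
    have hl' : (2 : ℝ) ≤ lOf m := by exact_mod_cast hl
    have : (4 : ℝ) ≤ kOf m := by nlinarith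
    exact_mod_cast (show (2 : ℝ) ≤ kOf m by linarith)
  have hε16 : epsOf c m ≤ 1 / 16 := by
    have hmc : (1 : ℝ) ≤ ((m ^ c : ℕ) : ℝ) := by exact_mod_cast Nat.one_le_pow c m hm1
    have hε0 := epsOf_nonneg c m
    nlinarith
  refine ⟨hl, hk, hkm, hq0, hq1, by linarith, by linarith⟩

/-- **`SGPerm` forbids one-PERM-gate CLIQUE at every polynomial width.** The child statement `SGPerm` of the
strategist split, VERBATIM as hypothesis, implies: for every `c`, eventually in `m`, no PERM gate on
`≤ m^c` points with its inputs wired to the edges computes `CLIQUE(m, ⌈m^{1/8}⌉₊)`. [folklore] -/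
theorem sgPerm_forces_onePermGate_blind : (∀ c : ℕ, ∀ᶠ m : ℕ in atTop, SGAt m (IsPermGate (m ^ c)) (lOf m) (kOf m) (qOf m) (epsOf c m)) → ∀ c : ℕ, ∀ᶠ m : ℕ in atTop, ∀ g : GateFn, IsPermGate (m ^ c) g → ∀ w : Fin g.1 → KEdge m, ¬ ∀ x : KEdge m → Bool, g.2 (fun i => x (w i)) = cliqueFn m (kOf m) x := by
  intro hSGPerm c
  filter_upwards [hSGPerm c, sgPerm_numerics c] with m hSG ⟨hl, hk, hkm, hq0, hq1, hε, hgap⟩ g hg w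
  exact not_computes_cliqueFn_of_sgAt hl hk hkm hq0 hq1 hε hgap hSG hg w

/-- **`SGPerm` is at least a superpolynomial monotone-span-program lower bound for `CLIQUE(m, ⌈m^{1/8}⌉₊)`.**
The child statement `SGPerm`, VERBATIM as hypothesis, implies: for every `c`, eventually in `m`, no monotone
span program over `𝔽₂` of dimension `#κ` with `2·#κ ≤ m^c` (any number of rows, rows owned by wires reading
edges) computes `CLIQUE(m, ⌈m^{1/8}⌉₊)`. [folklore] -/
theorem sgPerm_forces_mspDim_lowerBound : (∀ c : ℕ, ∀ᶠ m : ℕ in atTop, SGAt m (IsPermGate (m ^ c)) (lOf m) (kOf m) (qOf m) (epsOf c m)) → ∀ c : ℕ, ∀ᶠ m : ℕ in atTop, ∀ (κ : Type) [Fintype κ], 2 * Fintype.card κ ≤ m ^ c → ∀ (n : ℕ) (ρ : Fin n → κ → ZMod 2) (t : κ → ZMod 2) (w : Fin n → KEdge m), ¬ ∀ x : KEdge m → Bool, (Multiplicative.ofAdd t ∈ Subgroup.closure ((fun i => Multiplicative.ofAdd (ρ i)) '' {i | x (w i) = true}) ↔ cliqueFn m (kOf m) x = true) := by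
  intro hSGPerm c
  filter_upwards [hSGPerm c, sgPerm_numerics c] with m hSG ⟨hl, hk, hkm, hq0, hq1, hε, hgap⟩ κ _ hκ n ρ t w
  exact not_spanProgram_cliqueFn_of_sgAt_perm hl hk hkm hq0 hq1 hε hgap hSG hκ ρ t w

/-- **Abelian form over any finite abelian group** (`#G·#κ ≤ m^c`; `G = ZMod p` = monotone span programs
over `𝔽_p` of dimension `≤ m^c / p`). [folklore] -/
theorem sgPerm_forces_abelianProgram_lowerBound : (∀ c : ℕ, ∀ᶠ m : ℕ in atTop, SGAt m (IsPermGate (m ^ c)) (lOf m) (kOf m) (qOf m) (epsOf c m)) → ∀ c : ℕ, ∀ᶠ m : ℕ in atTop, ∀ (G : Type) [AddCommGroup G] [Fintype G] [DecidableEq G] (κ : Type) [Fintype κ] [DecidableEq κ], Fintype.card G * Fintype.card κ ≤ m ^ c → ∀ (n : ℕ) (ρ : Fin n → κ → G) (t : κ → G) (w : Fin n → KEdge m), ¬ ∀ x : KEdge m → Bool, (Multiplicative.ofAdd t ∈ Subgroup.closure ((fun i => Multiplicative.ofAdd (ρ i)) '' {i | x (w i) = true}) ↔ cliqueFn m (kOf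 m) x = true) := by
  intro hSGPerm c
  filter_upwards [hSGPerm c, sgPerm_numerics c] with m hSG ⟨hl, hk, hkm, hq0, hq1, hε, hgap⟩
    G _ _ _ κ _ _ hGκ n ρ t w
  exact not_abelianProgram_cliqueFn_of_sgAt_perm hl hk hkm hq0 hq1 hε hgap hSG hGκ ρ t w

end Summit.PneNP.PneNP.Theorems

end
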